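import Summits.KontsevichZagierPeriods.KontsevichZagierPeriods.Theses.SymplecticScissors
import Literature.NumberTheory.Transcendental.AyoubPeriodSeries
import Literature.NumberTheory.Transcendental.AyoubPeriodSeriesKernel
import Literature.NumberTheory.Transcendental.AyoubPeriodSeriesPiAlgebraic
import Literature.NumberTheory.Transcendental.AyoubPeriodSeriesLocalizing
import Summits.KontsevichZagierPeriods.KontsevichZagierPeriods.Theorems.SymplecticScissorsTypeAGenerationStubRestrCOneAux
import Summits.KontsevichZagierPeriods.KontsevichZagierPeriods.Theorems.SymplecticScissorsTypeAGenerationStubBinGermCalculus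
import Summits.KontsevichZagierPeriods.KontsevichZagierPeriods.Theorems.SymplecticScissorsTypeAGenerationStubUnitOfSmallDeviation
import Summits.KontsevichZagierPeriods.KontsevichZagierPeriods.Theorems.SymplecticScissorsTypeAGenerationStubPdzMemOan

/-!
# `TypeAGeneration` (stmt-KontsevichZagierPeriods-18392), line `Sketch`, stub
`stub_binGermMemOan` (G1): binomial germs `(1 − zᵢ/α)^q` lie in `𝒪_{ℚ-alg}(𝔻̄^∞)`

Registered stub `stub_binGermMemOan` of the crux `TypeAGeneration` (route SymplecticScissors,
line `Sketch` = card stokes-compiler, cycle 2, Layer 1 = Ayoub's Conjecture 1.1 for one-variable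
rational integrands), on top of `Literature/NumberTheory/Transcendental/AyoubPeriodSeries.lean`
(`AyoubRel.Oan σ = 𝒪_{k-alg}(𝔻̄^∞)`: power series in finitely many `zᵢ`, of polyradius `> 1`,
algebraic over `k(z)`), `…AyoubPeriodSeriesLocalizing.lean` (the axis embedding `axisEmb i`,
the pattern `perGerm`) and the sibling stub file `…StubBinGermCalculus.lean` (G2: coefficients and
exponent law of the binomial germ).

The **binomial germ** `binGerm[i, α, a] = (1 − zᵢ/α)^a ∈ ℂ[[z]]` is Mathlib's `(1 + X)^a`
(`PowerSeries.binomialSeries ℂ a`, coefficients `Ring.choose a n`) rescaled by `X ↦ −α⁻¹ X` and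
renamed into the variable `zᵢ`.  For `α` algebraic over `ℚ` with `‖α‖ > 1` and `q ∈ ℚ` we prove:

* the germ depends on `zᵢ` only (`g1_dependsOnlyOnLT_binGerm`, `g1_eq_of_usesVar_binGerm`; the
  coefficients — `C(a, n) (−α⁻¹)ⁿ` on the `zᵢ`-axis, `0` off it — and the exponent law are the
  sibling stub file's `g2_coeff_single`, `g2_coeff_of_ne`, `g2_binGerm_add`, `g2_binGerm_zero`);
* the recursion `C(r, n+1) = C(r, n) (r − n)/(n + 1)` in `ℂ` (`g1_choose_succ`) and the
  **coefficient bound** `‖C(q, n)‖ ≤ |q|` for `|q| ≤ 1`, `n ≥ 1` (`g1_norm_choose_le`);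
* `Σ_n ‖C(a, n)‖ xⁿ < ∞` for `0 ≤ x < 1` (Mathlib: the binomial series has radius `≥ 1`,
  `binomialSeries_radius_ge_one`), whence the weighted `ℓ¹`-norm of the germ is finite for every
  weight `ρ ≥ 0` with `ρᵢ < ‖α‖` (`g1_summable_weighted`) and the polyradius is `> 1`;
* algebraicity over `ℚ(z)`: `(binGerm q)^{den q} = binGerm (num q)` (exponent law),
  `binGerm N = (1 + (−α⁻¹) zᵢ)^N` for `N ∈ ℕ`
  (`PowerSeries.binomialSeries_nat`) and `binGerm (−N)` is its inverse; conclude with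
  `IsAlgebraic.of_pow`.

Elementary (folklore); no definition is introduced (`binGerm[i, α, a]` is a local notation).
-/

noncomputable section

-- `Summit.KontsevichZagierPeriods.KontsevichZagierPeriods.…` is the tree's mandated layout (single-conjunct summit).
set_option linter.dupNamespace false

namespace Summit.KontsevichZagierPeriods.KontsevichZagierPeriods.TypeAGenerationLine

open Finsupp MvPowerSeries
open Literature.NumberTheory.Transcendental
open Literature.NumberTheory.Transcendental.AyoubRel

/-- The binomial germ `(1 − zᵢ/α)^a ∈ ℂ[[z]]`. -/
local notation3 "binGerm[" i ", " α ", " a "]" =>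
  (MvPowerSeries.rename (⇑(axisEmb i))
    (PowerSeries.rescale (-(α : ℂ)⁻¹) (PowerSeries.binomialSeries ℂ (a : ℂ)) : MvPowerSeries Unit ℂ) :
    CSeries)

/-! ## Variables of the binomial germ (coefficients: `g2_coeff_single`, `g2_coeff_of_ne`) -/

/-- `(1 − zᵢ/α)^a` depends only on `z_0, …, z_i`. [folklore] -/
theorem g1_dependsOnlyOnLT_binGerm (i : ℕ) (α a : ℂ) :
    DependsOnlyOnLT (binGerm[i, α, a]) (i + 1) := by
  rintro x ⟨l, hl, hxl⟩
  refine g2_coeff_of_ne i α a fun n hn => hxl ?_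
  rw [hn, single_apply, if_neg]
  omega

/-- `(1 − zᵢ/α)^a` involves only the variable `zᵢ`. [folklore] -/
theorem g1_eq_of_usesVar_binGerm {i l : ℕ} {α a : ℂ} (h : UsesVar (binGerm[i, α, a]) l) :
    l = i := by
  obtain ⟨x, hxl, hne⟩ := h
  by_contra hli
  refine hne (g2_coeff_of_ne i α a fun n hn => hxl ?_)
  rw [hn, single_apply, if_neg (Ne.symm hli)]

/-! ## The binomial coefficients `C(r, n) = Ring.choose r n` in `ℂ` -/

/-- **Recursion** `C(r, n+1) = C(r, n) (r − n)/(n + 1)` in `ℂ`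
(`n! C(r, n) = r (r−1) ⋯ (r−n+1)`, `Ring.choose_eq_smul`, `descPochhammer_succ_right`). [folklore] -/
theorem g1_choose_succ (r : ℂ) (n : ℕ) :
    Ring.choose r (n + 1) = Ring.choose r n * (r - n) / (n + 1) := by
  rw [Ring.choose_eq_smul, Ring.choose_eq_smul, descPochhammer_succ_right, Polynomial.smeval_mul,
    Polynomial.smeval_sub, Polynomial.smeval_X, Polynomial.smeval_natCast, pow_one, pow_zero,
    nsmul_eq_mul, mul_one, Nat.factorial_succ, Nat.cast_mul, Nat.cast_succ, mul_inv]
  simp only [smul_eq_mul]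
  ring

/-- `‖C(r, n+1)‖ = ‖C(r, n)‖ ‖r − n‖/(n + 1)`. [folklore] -/
theorem g1_norm_choose_succ (r : ℂ) (n : ℕ) :
    ‖Ring.choose r (n + 1)‖ = ‖Ring.choose r n‖ * ‖r - n‖ / (n + 1) := by
  have h : ‖(n : ℂ) + 1‖ = n + 1 := by
    rw [show (n : ℂ) + 1 = ((n + 1 : ℕ) : ℂ) by norm_cast, Complex.norm_natCast]
    norm_cast
  rw [g1_choose_succ, norm_div, norm_mul, h]

/-- For `‖r‖ ≤ 1` the coefficients do not grow: `‖C(r, n+1)‖ ≤ ‖C(r, n)‖`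
(`‖r − n‖ ≤ ‖r‖ + n ≤ n + 1`). [folklore] -/
theorem g1_norm_choose_succ_le {r : ℂ} (hr : ‖r‖ ≤ 1) (n : ℕ) :
    ‖Ring.choose r (n + 1)‖ ≤ ‖Ring.choose r n‖ := by
  rw [g1_norm_choose_succ, div_le_iff₀ (by positivity)]
  refine mul_le_mul_of_nonneg_left ?_ (norm_nonneg _)
  calc ‖r - n‖ ≤ ‖r‖ + ‖(n : ℂ)‖ := norm_sub_le _ _
    _ ≤ n + 1 := by rw [Complex.norm_natCast]; linarith

/-- **The coefficient bound** `‖C(q, n)‖ ≤ |q|` for `q ∈ ℚ`, `|q| ≤ 1`, `n ≥ 1`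
(`C(q, 1) = q` and the coefficients do not grow). [folklore] -/
theorem g1_norm_choose_le {q : ℚ} (hq : |q| ≤ 1) {n : ℕ} (hn : 1 ≤ n) :
    ‖Ring.choose (q : ℂ) n‖ ≤ |(q : ℝ)| := by
  have hq' : ‖(q : ℂ)‖ ≤ 1 := by
    rw [Complex.norm_ratCast]
    exact_mod_cast hq
  induction n, hn using Nat.le_induction with
  | base => rw [Ring.choose_one_right, Complex.norm_ratCast]
  | succ n _ ih => exact (g1_norm_choose_succ_le hq' n).trans ih

/-- **`Σ_n ‖C(a, n)‖ xⁿ < ∞` for `0 ≤ x < 1`**: the binomial series `Σ C(a, n) Xⁿ` has radius of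
convergence `≥ 1` (Mathlib `binomialSeries_radius_ge_one`). [folklore] -/
theorem g1_summable_norm_choose_mul_pow (a : ℂ) {x : ℝ} (hx0 : 0 ≤ x) (hx1 : x < 1) :
    Summable fun n : ℕ => ‖Ring.choose a n‖ * x ^ n := by
  lift x to NNReal using hx0
  have hx : x < 1 := by exact_mod_cast hx1
  have hr : (x : ENNReal) < (binomialSeries ℂ a).radius :=
    lt_of_lt_of_le (by exact_mod_cast hx) binomialSeries_radius_ge_one
  have h := (binomialSeries ℂ a).summable_norm_mul_pow hr
  simpa [binomialSeries, FormalMultilinearSeries.ofScalars_norm] using h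

/-! ## Analytic size of the binomial germ -/

/-- **Weighted `ℓ¹`-norm of `(1 − zᵢ/α)^a`**: for weights `ρ ≥ 0` with `ρᵢ < ‖α‖`,
`Σ_x ‖coeff_x‖ ρ^x = Σ_n ‖C(a, n)‖ (ρᵢ/‖α‖)ⁿ < ∞`. [folklore] -/
theorem g1_summable_weighted (i : ℕ) {α : ℂ} (hα : 1 < ‖α‖) (a : ℂ) (ρ : ℕ → ℝ)
    (hρ : ∀ l, 0 ≤ ρ l) (hρi : ρ i < ‖α‖) :
    Summable fun x : ℕ →₀ ℕ => ‖coeff x (binGerm[i, α, a])‖ * x.prod fun l n => ρ l ^ n := by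
  have hα0 : 0 < ‖α‖ := one_pos.trans hα
  have ht0 : 0 ≤ ρ i / ‖α‖ := div_nonneg (hρ i) hα0.le
  have ht1 : ρ i / ‖α‖ < 1 := (div_lt_one hα0).mpr hρi
  have key : Summable ((fun x : ℕ →₀ ℕ =>
      ‖coeff x (binGerm[i, α, a])‖ * x.prod fun l n => ρ l ^ n) ∘ (single i : ℕ → ℕ →₀ ℕ)) := by
    refine (g1_summable_norm_choose_mul_pow a ht0 ht1).congr fun n => ?_
    simp only [Function.comp_apply]
    rw [g2_coeff_single, s4_weight_single, norm_mul, norm_pow, norm_neg, norm_inv,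
      div_pow, inv_pow]
    ring
  refine (Function.Injective.summable_iff (single_injective i) ?_).mp key
  intro x hx
  rw [g2_coeff_of_ne i α a fun n hn => hx ⟨n, hn.symm⟩, norm_zero, zero_mul]

/-- **`(1 − zᵢ/α)^a` has polyradius of convergence `> 1`** for `‖α‖ > 1` (weights
`ρ ≡ (1 + ‖α‖)/2`). [folklore] -/
theorem g1_hasPolyradiusGtOne_binGerm (i : ℕ) {α : ℂ} (hα : 1 < ‖α‖) (a : ℂ) :
    HasPolyradiusGtOne (binGerm[i, α, a]) := by
  refine ⟨(1 + ‖α‖) / 2, by linarith, ?_⟩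
  refine (g1_summable_weighted i hα a (fun _ => (1 + ‖α‖) / 2) (fun _ => by linarith)
    (by linarith)).congr fun x => ?_
  simp only [Finsupp.prod, Finsupp.degree_apply, Finset.prod_pow_eq_pow_sum]

/-! ## Algebraicity of the binomial germ over `ℚ(z)` -/

/-- `((1 − zᵢ/α)^a)^D = (1 − zᵢ/α)^{D a}` for `D ∈ ℕ` (exponent law `g2_binGerm_add`). [folklore] -/
theorem g1_binGerm_pow (i : ℕ) (α a : ℂ) (D : ℕ) :
    binGerm[i, α, a] ^ D = binGerm[i, α, (D : ℂ) * a] := by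
  induction D with
  | zero => rw [pow_zero, Nat.cast_zero, zero_mul, g2_binGerm_zero]
  | succ D ih =>
    have h : ((D + 1 : ℕ) : ℂ) * a = (D : ℂ) * a + a := by push_cast; ring
    rw [h, g2_binGerm_add, pow_succ, ih]

/-- `(1 − zᵢ/α)^q` to the power `den q` is `(1 − zᵢ/α)^{num q}`. [folklore] -/
theorem g1_binGerm_pow_den (i : ℕ) (α : ℂ) (q : ℚ) :
    binGerm[i, α, (q : ℂ)] ^ q.den = binGerm[i, α, (q.num : ℂ)] := by
  have h : ((q.den : ℕ) : ℂ) * (q : ℂ) = ((q.num : ℤ) : ℂ) := by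
    rw [mul_comm]
    exact_mod_cast Rat.mul_den_eq_num q
  rw [g1_binGerm_pow, h]

/-- For `N ∈ ℕ`, `(1 − zᵢ/α)^N` is the polynomial `(1 + (−α⁻¹) zᵢ)^N`
(`PowerSeries.binomialSeries_nat`). [folklore] -/
theorem g1_binGerm_natCast (i : ℕ) (α : ℂ) (N : ℕ) :
    binGerm[i, α, (N : ℂ)] = (1 + C (-α⁻¹) * X i) ^ N := by
  rw [PowerSeries.binomialSeries_nat, map_pow, map_add, map_one, PowerSeries.rescale_X,
    PowerSeries.C_apply, PowerSeries.X_apply, map_pow, map_add, map_one, map_mul,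
    rename_axisEmb_C, rename_axisEmb_X]

/-- `−α⁻¹` is algebraic over `ℚ` (along `algebraMap ℚ ℂ`) for `α` algebraic. [folklore] -/
theorem g1_algebraic_neg_inv {α : ℂ} (hα : IsAlgebraic ℚ α) :
    ∃ p : Polynomial ℚ, p ≠ 0 ∧ Polynomial.eval₂ (algebraMap ℚ ℂ) (-α⁻¹) p = 0 := by
  obtain ⟨p, hp, hpc⟩ := hα.inv.neg
  exact ⟨p, hp, hpc⟩

/-- For `N ∈ ℕ` and `α` algebraic, `(1 − zᵢ/α)^N` is algebraic over `ℚ(z)`. [folklore] -/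
theorem g1_isAlg_natCast (i : ℕ) {α : ℂ} (hα : IsAlgebraic ℚ α) (N : ℕ) :
    IsAlgebraicOverRatFunc (algebraMap ℚ ℂ) (binGerm[i, α, (N : ℂ)]) := by
  rw [g1_binGerm_natCast]
  refine w2_isAlg_pow (algebraMap ℚ ℂ) ?_ N
  exact (one_mem_Oan (algebraMap ℚ ℂ)).2.2.add (algebraMap ℚ ℂ)
    ((isAlgebraicOverRatFunc_C (algebraMap ℚ ℂ) (g1_algebraic_neg_inv hα)).mul (algebraMap ℚ ℂ)
      (isAlgebraicOverRatFunc_X (algebraMap ℚ ℂ) i))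

/-- For `m ∈ ℤ` and `α` algebraic, `(1 − zᵢ/α)^m` is algebraic over `ℚ(z)` (for `m = −N` it is
the inverse of `(1 − zᵢ/α)^N`). [folklore] -/
theorem g1_isAlg_intCast (i : ℕ) {α : ℂ} (hα : IsAlgebraic ℚ α) (m : ℤ) :
    IsAlgebraicOverRatFunc (algebraMap ℚ ℂ) (binGerm[i, α, (m : ℂ)]) := by
  obtain ⟨N, rfl | rfl⟩ := Int.eq_nat_or_neg m
  · rw [Int.cast_natCast]
    exact g1_isAlg_natCast i hα N
  · refine u2_isAlgebraic_of_mul_eq_one (algebraMap ℚ ℂ) (g1_isAlg_natCast i hα N) ?_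
    rw [Int.cast_neg, Int.cast_natCast, ← g2_binGerm_add, add_neg_cancel, g2_binGerm_zero]

/-- **For `q ∈ ℚ` and `α` algebraic, `(1 − zᵢ/α)^q` is algebraic over `ℚ(z)`**: its `den q`-th
power is (`IsAlgebraic.of_pow`). [folklore] -/
theorem g1_isAlg_ratCast (i : ℕ) {α : ℂ} (hα : IsAlgebraic ℚ α) (q : ℚ) :
    IsAlgebraicOverRatFunc (algebraMap ℚ ℂ) (binGerm[i, α, (q : ℂ)]) := by
  letI : Algebra (MvPolynomial ℕ ℚ) CSeries := (polyToCSeries (algebraMap ℚ ℂ)).toAlgebra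
  have h := g1_isAlg_intCast i hα q.num
  rw [← g1_binGerm_pow_den] at h
  exact (isAlgebraicOverRatFunc_iff_isAlgebraic _ _).mpr
    (IsAlgebraic.of_pow q.den_pos ((isAlgebraicOverRatFunc_iff_isAlgebraic _ _).mp h))

/-! ## The stub -/

/-- **G1 — binomial germs are in `𝒪_{ℚ-alg}(𝔻̄^∞)`.** For `α` algebraic with `‖α‖ > 1` and
`q ∈ ℚ`: `(1 − zᵢ/α)^q ∈ 𝒪_{ℚ-alg}(𝔻̄^∞)` (algebraic: its `den q`-th power is the rational function
`(1 − zᵢ/α)^{num q}`; polyradius `‖α‖ > 1`: Mathlib `binomialSeries_radius_ge_one`), it involves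
`zᵢ` only, its weighted norm is finite for every weight `ρ ≥ 0` with `ρᵢ < ‖α‖`, and
`‖C(q, n)‖ ≤ |q|` for `|q| ≤ 1`, `n ≥ 1`. [cite: Ayoub2015, Rem. 1.5] -/
theorem stub_binGermMemOan :
    ∀ (i : ℕ) (α : ℂ), IsAlgebraic ℚ α → 1 < ‖α‖ → ∀ (q : ℚ),
      binGerm[i, α, (q : ℂ)] ∈ Oan (algebraMap ℚ ℂ) ∧
      (∀ l : ℕ, UsesVar (binGerm[i, α, (q : ℂ)]) l → l = i) ∧
      (∀ ρ : ℕ → ℝ, (∀ l, 0 ≤ ρ l) → ρ i < ‖α‖ →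
        Summable fun a : ℕ →₀ ℕ =>
          ‖MvPowerSeries.coeff a (binGerm[i, α, (q : ℂ)])‖ * a.prod fun l n => ρ l ^ n) ∧
      (|q| ≤ 1 → ∀ n : ℕ, 1 ≤ n → ‖Ring.choose (q : ℂ) n‖ ≤ |(q : ℝ)|) := by
  intro i α hα hα1 q
  exact ⟨⟨⟨i + 1, g1_dependsOnlyOnLT_binGerm i α _⟩, g1_hasPolyradiusGtOne_binGerm i hα1 _,
      g1_isAlg_ratCast i hα q⟩,
    fun l hl => g1_eq_of_usesVar_binGerm hl,
    fun ρ hρ hρi => g1_summable_weighted i hα1 _ ρ hρ hρi,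
    fun hq n hn => g1_norm_choose_le hq hn⟩

end Summit.KontsevichZagierPeriods.KontsevichZagierPeriods.TypeAGenerationLine
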